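import Literature.Analysis.FluidPDE.LerayHopf
import HarnessLib

/-!
# Leray–Hopf solutions on the torus: the datum only matters up to a null set

Analysis/FluidPDE support file (all proved). The accepted `Torus.IsLerayHopfOn T ν f u₀ u`
(Leray 1934, §III; Galdi 2000, Def. 2.1) sees the initial datum `u₀` only through Bochner
integrals (`∫ ⟪u₀, ψ(0)⟫` in the weak identity, `½∫‖u₀‖²` in the energy inequality from `0`,
the weak limit `∫ ⟪u₀, w⟫` and the strong trace `‖u(t) - u₀‖₂ → 0`), hence is invariant under
modification of `u₀` on a null set:

* `Torus.IsWeakNSSolutionForcedOn.congr_datum_ae`, `Torus.IsLerayHopfOn.congr_datum_ae`,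
  `Torus.IsGlobalLerayHopf.congr_datum_ae`.

This is the device that lets one replace an `L²` datum that is symmetric only almost
everywhere (e.g. independent of one coordinate a.e., as the strong `L²` trace of symmetric
slices) by an everywhere symmetric representative (Majda–Bertozzi 2002, §2.3.1).

## References

* G. P. Galdi, *An introduction to the Navier–Stokes initial-boundary value problem* (2000),
  Def. 2.1.
* A. J. Majda, A. L. Bertozzi, *Vorticity and Incompressible Flow* (CUP 2002), §2.3.1.
-/

noncomputable section

open _root_.MeasureTheory _root_.Set _root_.Filter _root_.Topology
open scoped InnerProductSpace RealInnerProductSpace ENNReal NNReal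

namespace Literature.Analysis.FluidPDE.Torus

variable {d : Type*} [Fintype d] [DecidableEq d]
variable {T ν : ℝ} {f u : ℝ → UnitAddTorus d → EuclideanSpace ℝ d}
  {u₀ u₀' : UnitAddTorus d → EuclideanSpace ℝ d}

omit [DecidableEq d] in
/-- Pairings with a.e.-equal fields coincide: `∫ ⟪u₀', w⟫ = ∫ ⟪u₀, w⟫` if `u₀' = u₀` a.e. [folklore] -/
theorem integral_inner_congr_ae_left (h : u₀' =ᵐ[volume] u₀) (w : UnitAddTorus d → EuclideanSpace ℝ d) :
    ∫ x, ⟪u₀' x, w x⟫ = ∫ x, ⟪u₀ x, w x⟫ := by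
  refine integral_congr_ae ?_
  filter_upwards [h] with x hx
  rw [hx]

omit [DecidableEq d] in
/-- The kinetic energy only depends on the a.e. class of the field. [folklore] -/
theorem kineticEnergy_congr_ae (h : u₀' =ᵐ[volume] u₀) :
    FunctionSpaces.Torus.kineticEnergy u₀' = FunctionSpaces.Torus.kineticEnergy u₀ := by
  unfold FunctionSpaces.Torus.kineticEnergy
  congr 1
  refine integral_congr_ae ?_
  filter_upwards [h] with x hx
  rw [hx]

/-- **The forced weak formulation with datum is invariant under a.e. modification of the
datum** (the datum enters only through `∫ ⟪u₀, ψ(0)⟫`). [folklore] -/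
theorem IsWeakNSSolutionForcedOn.congr_datum_ae (hu : IsWeakNSSolutionForcedOn T ν f u₀ u)
    (h : u₀' =ᵐ[volume] u₀) : IsWeakNSSolutionForcedOn T ν f u₀' u := by
  refine ⟨hu.1, hu.2.1, hu.2.2.1, fun ψ hψ hdiv => ?_⟩
  rw [integral_inner_congr_ae_left h]
  exact hu.2.2.2 ψ hψ hdiv

/-- **Leray–Hopf solutions on the torus only see the a.e. class of the datum**: if `u` is a
Leray–Hopf solution on `[0, T)` with datum `u₀` and `u₀' = u₀` a.e., then `u` is a Leray–Hopf
solution with datum `u₀'` (every field of `Torus.IsLerayHopfOn` involves `u₀` only through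
Bochner integrals / `L²` norms; Galdi 2000, Def. 2.1). [folklore] -/
theorem IsLerayHopfOn.congr_datum_ae (hu : IsLerayHopfOn T ν f u₀ u) (h : u₀' =ᵐ[volume] u₀) :
    IsLerayHopfOn T ν f u₀' u where
  weak := hu.weak.congr_datum_ae h
  energy_bound := hu.energy_bound
  memLp := hu.memLp
  memL2Sobolev := hu.memL2Sobolev
  energy_ineq_zero t ht := by
    rw [kineticEnergy_congr_ae h]
    exact hu.energy_ineq_zero t ht
  energy_ineq_ae := hu.energy_ineq_ae
  weak_continuous w hw := by
    rw [integral_inner_congr_ae_left h]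
    exact hu.weak_continuous w hw
  strong_initial := by
    have he : ∀ t, eLpNorm (u t - u₀') 2 volume = eLpNorm (u t - u₀) 2 volume := fun t =>
      eLpNorm_congr_ae (h.mono fun x hx => by simp only [Pi.sub_apply, hx])
    simp only [he]
    exact hu.strong_initial

/-- **Global Leray–Hopf solutions only see the a.e. class of the datum.** [folklore] -/
theorem IsGlobalLerayHopf.congr_datum_ae (hu : IsGlobalLerayHopf ν f u₀ u) (h : u₀' =ᵐ[volume] u₀) :
    IsGlobalLerayHopf ν f u₀' u :=
  fun T hT => (hu T hT).congr_datum_ae h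

end Literature.Analysis.FluidPDE.Torus

end
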